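import Mathlib
import Literature.Analysis.FluidPDE.SuitableWeak
import Literature.Analysis.FluidPDE.WeakSolution
import Literature.Analysis.FluidPDE.Seregin2023.TypeIIEulerZoom
import Literature.Analysis.FluidPDE.LocalLeraySlabGoodSlices
import HarnessLib

/-!
# Two inputs for the FINITE-BACKWARD-FLUX stratum of the crux `EulerZoomLiouville.PowerGaugeEulerLiouville`

Route `EulerZoomLiouville` (NavierStokesRegularity), crux E = stmt-NavierStokesRegularity-19832
`PowerGaugeEulerLiouville` (Seregin's power-gauged ancient Euler class is trivial; OPEN on `0 < ρ ≤ 1/2`).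
Companion of `EulerZoomLiouvillePowerGaugeEulerLiouvilleFlux.lean`, kept route-independent:

* `hasScaledLocalEnergyBound_of_gaugeA` — the `A`-gauge ALONE, `a^{2ρ} A(a;0) ≤ c` (`a > 0`), is the
  tree's `Seregin2023.HasScaledLocalEnergyBound (1 − 2ρ) c u`;
* `ae_hasWeakGradient_slice_of_slab_Iio` — on an ancient slab `(−∞, T) × ℝ³`, a.e. slice of a weak
  spatial gradient is a weak gradient of the slice.

WHAT THIS IS NOT: not NS — bookkeeping. [folklore]
-/

noncomputable section

set_option linter.dupNamespace false

open MeasureTheory Set Filter Topology Metric Function TopologicalSpace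
open scoped ENNReal NNReal InnerProductSpace RealInnerProductSpace

namespace Summit.NavierStokesRegularity.NavierStokesRegularity.Theorems.PowerGaugeEulerLiouville

open Literature.Analysis Literature.Analysis.FunctionSpaces Literature.Analysis.FluidPDE

/-! ## The `A`-gauge alone as a scaled local-energy bound; slices on ancient slabs `(−∞, T)` -/

/-- **The `A`-gauge ALONE as a scaled local-energy bound**: `a^{2ρ} A(a; 0) ≤ c` for all `a > 0` gives
`∫_{B(a)} |u(s)|² ≤ c a^{1−2ρ}` for `s ∈ (−a², 0)` (the tree's `Seregin2023.HasScaledLocalEnergyBound`;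
cf. `hasScaledLocalEnergyBound_of_gauge` in `…Irrotational.lean`, which takes the full three-term gauge).
[folklore] -/
theorem hasScaledLocalEnergyBound_of_gaugeA {ρ : ℝ}
    {u : ℝ → EuclideanSpace ℝ (Fin 3) → EuclideanSpace ℝ (Fin 3)} {c : ℝ≥0}
    (hAterm' : ∀ a : ℝ, 0 < a →
      ENNReal.ofReal (a ^ (2 * ρ)) * cknA a (0 : ℝ × EuclideanSpace ℝ (Fin 3)) u ≤ (c : ℝ≥0∞)) :
    Seregin2023.HasScaledLocalEnergyBound (1 - 2 * ρ) c u := by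
  intro a ha s hs
  have hAterm := hAterm' a ha
  have hslice : (ENNReal.ofReal a)⁻¹ * ∫⁻ x in ball (0 : EuclideanSpace ℝ (Fin 3)) a, ‖u s x‖ₑ ^ 2 ≤
      cknA a (0 : ℝ × EuclideanSpace ℝ (Fin 3)) u := by
    unfold cknA
    have hs' : s ∈ Ioo ((0 : ℝ × EuclideanSpace ℝ (Fin 3)).1 - a ^ 2) (0 : ℝ × EuclideanSpace ℝ (Fin 3)).1 := by
      simpa using hs
    exact le_iSup₂ (f := fun t (_ : t ∈ Ioo ((0 : ℝ × EuclideanSpace ℝ (Fin 3)).1 - a ^ 2)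
      (0 : ℝ × EuclideanSpace ℝ (Fin 3)).1) =>
      (ENNReal.ofReal a)⁻¹ * ∫⁻ x in ball (0 : ℝ × EuclideanSpace ℝ (Fin 3)).2 a, ‖u t x‖ₑ ^ 2) s hs'
  have hB0 : ENNReal.ofReal (a ^ (2 * ρ)) ≠ 0 := by
    rw [ENNReal.ofReal_ne_zero_iff]; exact Real.rpow_pos_of_pos ha _
  have hA0 : ENNReal.ofReal a ≠ 0 := by rw [ENNReal.ofReal_ne_zero_iff]; exact ha
  have h2 : ENNReal.ofReal (a ^ (2 * ρ)) *
      ((ENNReal.ofReal a)⁻¹ * ∫⁻ x in ball (0 : EuclideanSpace ℝ (Fin 3)) a, ‖u s x‖ₑ ^ 2) ≤ (c : ℝ≥0∞) :=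
    le_trans (mul_le_mul_right hslice _) hAterm
  have h3 : ∫⁻ x in ball (0 : EuclideanSpace ℝ (Fin 3)) a, ‖u s x‖ₑ ^ 2 ≤
      ENNReal.ofReal a * (ENNReal.ofReal (a ^ (2 * ρ)))⁻¹ * (c : ℝ≥0∞) := by
    have key : ∫⁻ x in ball (0 : EuclideanSpace ℝ (Fin 3)) a, ‖u s x‖ₑ ^ 2 =
        ENNReal.ofReal a * (ENNReal.ofReal (a ^ (2 * ρ)))⁻¹ *
          (ENNReal.ofReal (a ^ (2 * ρ)) *
            ((ENNReal.ofReal a)⁻¹ * ∫⁻ x in ball (0 : EuclideanSpace ℝ (Fin 3)) a, ‖u s x‖ₑ ^ 2)) := by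
      rw [← mul_assoc, mul_assoc (ENNReal.ofReal a), ENNReal.inv_mul_cancel hB0 ENNReal.ofReal_ne_top,
        mul_one, ← mul_assoc, ENNReal.mul_inv_cancel hA0 ENNReal.ofReal_ne_top, one_mul]
    rw [key]
    exact mul_le_mul_right h2 _
  refine le_trans h3 (le_of_eq ?_)
  rw [← ENNReal.ofReal_inv_of_pos (Real.rpow_pos_of_pos ha _), ← ENNReal.ofReal_mul ha.le,
    ENNReal.coe_nnreal_eq, ← ENNReal.ofReal_mul (by positivity)]
  congr 1
  rw [mul_comm, Real.rpow_sub ha, Real.rpow_one, div_eq_mul_inv]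

/-- **Slices of a weak spatial gradient on an ancient slab `(−∞, T) × ℝ³`**: for a.e. `t < T` the slice
`H t` is a weak gradient of `u t` on `ℝ³` (cf. `ae_hasWeakGradient_slice_of_slab` in `…Irrotational.lean`,
the case `T = 0`). [folklore] -/
theorem ae_hasWeakGradient_slice_of_slab_Iio {T : ℝ}
    {u : ℝ → EuclideanSpace ℝ (Fin 3) → EuclideanSpace ℝ (Fin 3)}
    {H : ℝ → EuclideanSpace ℝ (Fin 3) → EuclideanSpace ℝ (Fin 3) →L[ℝ] EuclideanSpace ℝ (Fin 3)}
    (hH : HasWeakSpatialGradientOn (slab (EuclideanSpace ℝ (Fin 3)) (Iio T) isOpen_Iio) u H) :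
    ∀ᵐ t ∂(volume.restrict (Iio T)), HasWeakGradient (u t) (H t) := by
  have hU : (⋃ n : ℕ, Ioo (T - ((n : ℝ) + 1)) T) = Iio T := by
    refine subset_antisymm (iUnion_subset fun n t ht => ht.2) fun t ht => ?_
    obtain ⟨n, hn⟩ := exists_nat_gt (T - t)
    exact mem_iUnion.2 ⟨n, ⟨by linarith, ht⟩⟩
  rw [← hU, ae_restrict_iUnion_iff]
  intro n
  have hn : HasWeakSpatialGradientOn (slab (EuclideanSpace ℝ (Fin 3)) (Ioo (T - ((n : ℝ) + 1)) T) isOpen_Ioo) u H :=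
    hH.mono (slab_mono Ioo_subset_Iio_self)
  exact hn.ae_hasWeakFDerivOn_slice_slab

end Summit.NavierStokesRegularity.NavierStokesRegularity.Theorems.PowerGaugeEulerLiouville

end
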